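import Literature.NumberTheory.Automorphic.ArchRankOneJumpZeroCone          -- ★ p850353 (F0P3a-p07 (g16)): `formCongr_cayleyTwo_of_eq_over` (`P̄ᵀ J P = diag(2,−2)`), the `U(J)`-with-`hJ` currency; brings ★ `det_cayleyTwo_ne_zero`, `coe_inv_cayleyTwo`, `conj_mem_unitaryGroupOfForm_iff`
import Literature.NumberTheory.Automorphic.ArchRankOneCasimirTorusPoint       -- ★ Z1 (A-p18 (g26)): `RankOneCasimir.casimir_conj_eq` (the `Ad(U(diag e))`-invariance of the Casimir seen by a REAL bilinear map)
import Mathlib.Analysis.Calculus.FDeriv.Symmetric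
import HarnessLib

/-!
# The Casimir of `U(J)`, `J = Φ₂ = antidiag(1,1)`, in the SPLIT frame: the flow decomposition `Ω = H̃² − 2H̃ − 4ẼF̃˜` and its `Ad(U(J))`-invariance
# (Harish-Chandra's radial component on the split Cartan, algebraic half; Varadarajan 1989 §6.3–6.4, Knapp 1986 Ch. VIII §5, Hall 2015 §3.6)

Topic `NumberTheory/Automorphic`; namespace `Literature.NumberTheory.Automorphic.UnitaryGroup`.  THEOREMS ONLY (no `def`, no instance, no notation, no axiom, no named fact, no
`sorry`).  Cell `pub/hodgecm-mathlib`, crux H413 (`stmt-HodgeConjecture-24833`), line LH3 (closer stub `stub_N9`, direct road), letter L1∕L3′ pay-down brick **(A0-CASIMIR-∞)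
«THE SPLIT SIDE'S CASIMIR LADDER», FILE 1 (algebra)** (F0P3a-p09 (g6); LH3-plan (g3) 2026-09-02T08:51:42Z «=»): the pointwise identities that turn the Casimir of
`U(1,1) = U(J)(ℂ)` into flows along the SPLIT torus `hypBlockGL x 0 = exp(xH)`, `H = diag(1,−1)`, and along its unipotent radical `N = exp(ℝ·E)`, `E = (0 i; 0 0)` — the
algebraic half of the radial equation `Λ_{Ωf} = ∂_x²Λ_f − Λ_f` of FILE 2 (`ArchRankOneSplitCasimirRadial`) for the `K × N` chart function `Λ` of ★ p850603∕p850189.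

THE FRAME.  ★ Z1∕Z3∕Z4 (`ArchRankOneCasimirTorusPoint` ∕ `…RadialEquation` ∕ `…LimitFormulaThirdJet`, A-p18) and LH3-p04's all-orders ladder write the `½tr`-Casimir of
`𝔰𝔲(diag e)` as `Ω = −X₁² + X̂₂² + X̂₃²`, `X₁ = diag(i,−i)`, `X̂₂ = (0 p; q 0)`, `X̂₃ = (0 −ip; iq 0)`, through LEFT-invariant fields: `(Ωg)(Y) = Σ ± (D²g(Y)[YX,YX] + Dg(Y)[YX²])`.
On the generic carrier `U(J)`, `hJ : J = (StdForm.antidiagonal 2).over ℂ` of ★ (A0-b) p850189 — where the split torus `hypBlockGL` and `N = unipotentU` are diagonal resp. upper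
triangular — the Cayley matrix `P = (1 1; 1 −1)` (★ `formCongr_cayleyTwo_of_eq_over`: `P̄ᵀ J P = diag(2,−2)`, so `p = q = 1`) transports that basis to
  `Y₁ = P X₁ P⁻¹ = (0 i; i 0)` (compact),  `H = P X̂₂ P⁻¹ = diag(1,−1)` (split),  `Y₃ = P X̂₃ P⁻¹ = (0 i; −i 0)`,
and `Ω_J g Y := −(D²g(Y)[YY₁,YY₁] + Dg(Y)[YY₁²]) + (D²g(Y)[YH,YH] + Dg(Y)[YH²]) + (D²g(Y)[YY₃,YY₃] + Dg(Y)[YY₃²])` — Z4's `hΩ` text with `(X₁,X̂₂,X̂₃) ↦ (Y₁,H,Y₃)`.  `Ω` enters every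
statement as a BOUND operator `Ω : (M₂(ℂ) → E) → M₂(ℂ) → E` with that defining hypothesis `hΩ` (nothing is defined here).

WHAT IS PROVED.
* §1 matrix units of the frame: `Y₁ = E + F̃`, `Y₃ = E − F̃` (`F̃ = (0 0; i 0)`), `Y₁² = −1`, `H² = 1 = Y₃²`, `E F̃ = −E₁₁`, `1 + H + 2EF̃ = 0`; the Cayley transport
  `P X₁ P⁻¹ = Y₁`, `P X̂₂ P⁻¹ = H`, `P X̂₃ P⁻¹ = Y₃`.
* §2 **`casimirJ_bilinear_eq_flows`** — for every `ℝ`-bilinear continuous `B` and linear `ℓ` with `B(YE, YF̃) = B(YF̃, YE)`: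
  `−(B(YY₁,YY₁) + ℓ(YY₁²)) + (B(YH,YH) + ℓ(YH²)) + (B(YY₃,YY₃) + ℓ(YY₃²)) = (B(YH,YH) + ℓ(YH²)) − 2•ℓ(YH) − 4•(B(YE,YF̃) + ℓ(Y·EF̃))`, i.e. as left-invariant operators
  **`Ω_J = H̃² − 2H̃ − 4ẼF̃˜`** (`[E,F̃] = −H`); and **`casimirJ_apply_eq_flows`** — the same for `B = D²g(Y)`, `ℓ = Dg(Y)`, `g ∈ C²` (symmetry of the second derivative,
  Mathlib `ContDiffAt.isSymmSndFDerivAt`).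
* §3 **`casimirJ_conj_eq_of_mem`** — `Ad(U(J))`-INVARIANCE: for `k ∈ U(J)` and every `ℝ`-bilinear `B`, `−B(kY₁k⁻¹, kY₁k⁻¹) + B(kHk⁻¹, kHk⁻¹) + B(kY₃k⁻¹, kY₃k⁻¹) = −B(Y₁,Y₁) + B(H,H) +
  B(Y₃,Y₃)` (★ `RankOneCasimir.casimir_conj_eq` for `U(diag(2,−2))` at `P⁻¹kP`, read through `B ∘ (Ad_P × Ad_P)`), and the first-order companion `Σ ± k Yᵢ² k⁻¹ = 3 = Σ ± Yᵢ²`.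
FILE 2 integrates §2 along the `K × N` chart (the `Ẽ`-flow is a total derivative along `N`, the `H̃`-flow rescales `N` by `e^{2s}`) and uses §3 to pass the chart variable `k ∈ K`
through `Ω`.  HONEST LABEL: elementary matrix calculus; count-neutral (HC_CM is proved only modulo the printed citations — 2 remaining named inputs hLiu418 =
`stmt-HodgeConjecture-24832`, h413 = `stmt-HodgeConjecture-24833` — until rung 0 closes).

## References
* [Varadarajan1989] V. S. Varadarajan, *An Introduction to Harmonic Analysis on Semisimple Lie Groups*, Cambridge Stud. Adv. Math. 16 (1989), §6.3 (radial components), §6.4 Thm 23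
  (`F_f` on the split Cartan via the Abel transform `e^{ρ}∫_N`).
* [Knapp1986] A. W. Knapp, *Representation Theory of Semisimple Groups* (1986), Ch. V §3 (`SU(1,1)`, Iwasawa coordinates), Ch. VIII §5 (the Harish-Chandra homomorphism `Ω ↦ H² − ρ²`).
* [Hall2015] B. C. Hall, *Lie Groups, Lie Algebras, and Representations*, GTM 222 (2015), §3.6, Prop. 3.24 (Casimir invariance under `Ad`).
* [Rogawski1990] J. D. Rogawski, *Automorphic Representations of Unitary Groups in Three Variables*, Ann. of Math. Stud. 123 (1990), §3.6 p. 31, §8.2 pp. 119–122.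
-/

set_option autoImplicit false

noncomputable section

open Complex Matrix
open scoped Matrix.Norms.Operator MatrixGroups ComplexConjugate

namespace Literature.NumberTheory.Automorphic

namespace UnitaryGroup

/-! ## §1 The split frame of `𝔲(J)`: `H`, `E`, `F̃`, `Y₁ = E + F̃`, `Y₃ = E − F̃`, and the Cayley transport from the diagonal frame -/

section Frame

/-- `Y₁ = E + F̃`: `(0 i; i 0) = (0 i; 0 0) + (0 0; i 0)`. [cite: Knapp1986, Ch. V §3] -/
theorem splitFrame_Y₁_eq_add : (!![0, I; I, 0] : Matrix (Fin 2) (Fin 2) ℂ) = !![0, I; 0, 0] + !![0, 0; I, 0] := by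
  ext i j; fin_cases i <;> fin_cases j <;> simp

/-- `Y₃ = E − F̃`: `(0 i; −i 0) = (0 i; 0 0) − (0 0; i 0)`. [cite: Knapp1986, Ch. V §3] -/
theorem splitFrame_Y₃_eq_sub : (!![0, I; -I, 0] : Matrix (Fin 2) (Fin 2) ℂ) = !![0, I; 0, 0] - !![0, 0; I, 0] := by
  ext i j; fin_cases i <;> fin_cases j <;> simp

/-- `Y₁² = −1` (the compact generator). [cite: Knapp1986, Ch. V §3] -/
theorem splitFrame_Y₁_mul_Y₁ : (!![0, I; I, 0] : Matrix (Fin 2) (Fin 2) ℂ) * !![0, I; I, 0] = -1 := by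
  ext i j; fin_cases i <;> fin_cases j <;> simp [Matrix.mul_apply, Fin.sum_univ_two]

/-- `H² = 1` (the split generator). [cite: Knapp1986, Ch. V §3] -/
theorem splitFrame_H_mul_H : (!![1, 0; 0, -1] : Matrix (Fin 2) (Fin 2) ℂ) * !![1, 0; 0, -1] = 1 := by
  ext i j; fin_cases i <;> fin_cases j <;> simp [Matrix.mul_apply, Fin.sum_univ_two]

/-- `Y₃² = 1` (the second noncompact generator). [cite: Knapp1986, Ch. V §3] -/
theorem splitFrame_Y₃_mul_Y₃ : (!![0, I; -I, 0] : Matrix (Fin 2) (Fin 2) ℂ) * !![0, I; -I, 0] = 1 := by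
  ext i j; fin_cases i <;> fin_cases j <;> simp [Matrix.mul_apply, Fin.sum_univ_two]

/-- `E F̃ = −E₁₁`. [cite: Knapp1986, Ch. V §3] -/
theorem splitFrame_E_mul_F : (!![0, I; 0, 0] : Matrix (Fin 2) (Fin 2) ℂ) * !![0, 0; I, 0] = !![-1, 0; 0, 0] := by
  ext i j; fin_cases i <;> fin_cases j <;> simp [Matrix.mul_apply, Fin.sum_univ_two]

/-- **`YH = −Y − 2•Y(EF̃)`** (`1 + H + 2EF̃ = 0`): the first-order bookkeeping of the flow decomposition. [cite: Varadarajan1989, §6.3] -/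
theorem mul_splitFrame_H_eq (Y : Matrix (Fin 2) (Fin 2) ℂ) :
    Y * !![1, 0; 0, -1] = -Y - (2 : ℝ) • (Y * (!![0, I; 0, 0] * !![0, 0; I, 0])) := by
  rw [splitFrame_E_mul_F]
  ext i j; fin_cases i <;> fin_cases j <;> simp [Matrix.mul_apply, Fin.sum_univ_two] <;> ring

/-- `Y·Y₁·Y₁ = −Y`. [cite: Knapp1986, Ch. V §3] -/
theorem mul_splitFrame_Y₁_mul_Y₁ (Y : Matrix (Fin 2) (Fin 2) ℂ) : Y * !![0, I; I, 0] * !![0, I; I, 0] = -Y := by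
  rw [Matrix.mul_assoc, splitFrame_Y₁_mul_Y₁, Matrix.mul_neg, Matrix.mul_one]

/-- `Y·H·H = Y`. [cite: Knapp1986, Ch. V §3] -/
theorem mul_splitFrame_H_mul_H (Y : Matrix (Fin 2) (Fin 2) ℂ) : Y * !![1, 0; 0, -1] * !![1, 0; 0, -1] = Y := by
  rw [Matrix.mul_assoc, splitFrame_H_mul_H, Matrix.mul_one]

/-- `Y·Y₃·Y₃ = Y`. [cite: Knapp1986, Ch. V §3] -/
theorem mul_splitFrame_Y₃_mul_Y₃ (Y : Matrix (Fin 2) (Fin 2) ℂ) : Y * !![0, I; -I, 0] * !![0, I; -I, 0] = Y := by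
  rw [Matrix.mul_assoc, splitFrame_Y₃_mul_Y₃, Matrix.mul_one]

/-- The Cayley matrix `P = (1 1; 1 −1)` as an element of `GL₂(ℂ)`: its value. [cite: Rogawski1990, §8.2 p. 122] -/
theorem coe_cayleyTwoGL :
    ((Matrix.GeneralLinearGroup.mkOfDetNeZero !![(1 : ℂ), 1; 1, -1] det_cayleyTwo_ne_zero : GL (Fin 2) ℂ) : Matrix (Fin 2) (Fin 2) ℂ) = !![(1 : ℂ), 1; 1, -1] := by
  rw [Matrix.GeneralLinearGroup.val_mkOfDetNeZero]

/-- **CAYLEY TRANSPORT OF THE COMPACT GENERATOR**: `P · diag(i,−i) · P⁻¹ = Y₁ = (0 i; i 0)`. [cite: Rogawski1990, §8.2 p. 122] [cite: Hall2015, §3.6] -/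
theorem cayleyTwo_conj_X₁ :
    ((Matrix.GeneralLinearGroup.mkOfDetNeZero !![(1 : ℂ), 1; 1, -1] det_cayleyTwo_ne_zero : GL (Fin 2) ℂ) : Matrix (Fin 2) (Fin 2) ℂ) * !![I, 0; 0, -I] *
        (((Matrix.GeneralLinearGroup.mkOfDetNeZero !![(1 : ℂ), 1; 1, -1] det_cayleyTwo_ne_zero)⁻¹ : GL (Fin 2) ℂ) : Matrix (Fin 2) (Fin 2) ℂ) = !![0, I; I, 0] := by
  rw [coe_cayleyTwoGL, coe_inv_cayleyTwo]
  ext i j; fin_cases i <;> fin_cases j <;> simp [Matrix.mul_apply, Fin.sum_univ_two] <;> ring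

/-- **CAYLEY TRANSPORT OF THE FIRST BOOST**: `P · (0 1; 1 0) · P⁻¹ = H = diag(1,−1)`. [cite: Rogawski1990, §8.2 p. 122] [cite: Hall2015, §3.6] -/
theorem cayleyTwo_conj_X₂ :
    ((Matrix.GeneralLinearGroup.mkOfDetNeZero !![(1 : ℂ), 1; 1, -1] det_cayleyTwo_ne_zero : GL (Fin 2) ℂ) : Matrix (Fin 2) (Fin 2) ℂ) *
        !![(0 : ℂ), ((1 : ℝ) : ℂ); ((1 : ℝ) : ℂ), 0] *
        (((Matrix.GeneralLinearGroup.mkOfDetNeZero !![(1 : ℂ), 1; 1, -1] det_cayleyTwo_ne_zero)⁻¹ : GL (Fin 2) ℂ) : Matrix (Fin 2) (Fin 2) ℂ) = !![1, 0; 0, -1] := by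
  rw [coe_cayleyTwoGL, coe_inv_cayleyTwo]
  ext i j; fin_cases i <;> fin_cases j <;> simp [Matrix.mul_apply, Fin.sum_univ_two] <;> ring

/-- **CAYLEY TRANSPORT OF THE SECOND BOOST**: `P · (0 −i; i 0) · P⁻¹ = Y₃ = (0 i; −i 0)`. [cite: Rogawski1990, §8.2 p. 122] [cite: Hall2015, §3.6] -/
theorem cayleyTwo_conj_X₃ :
    ((Matrix.GeneralLinearGroup.mkOfDetNeZero !![(1 : ℂ), 1; 1, -1] det_cayleyTwo_ne_zero : GL (Fin 2) ℂ) : Matrix (Fin 2) (Fin 2) ℂ) *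
        !![(0 : ℂ), -(((1 : ℝ) : ℂ) * I); ((1 : ℝ) : ℂ) * I, 0] *
        (((Matrix.GeneralLinearGroup.mkOfDetNeZero !![(1 : ℂ), 1; 1, -1] det_cayleyTwo_ne_zero)⁻¹ : GL (Fin 2) ℂ) : Matrix (Fin 2) (Fin 2) ℂ) = !![0, I; -I, 0] := by
  rw [coe_cayleyTwoGL, coe_inv_cayleyTwo]
  ext i j; fin_cases i <;> fin_cases j <;> simp [Matrix.mul_apply, Fin.sum_univ_two] <;> ring

end Frame

/-! ## §2 The flow decomposition `Ω_J = H̃² − 2H̃ − 4ẼF̃˜` -/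

section Flows

variable {E : Type*} [NormedAddCommGroup E] [NormedSpace ℝ E]

/-- **`Ω_J = H̃² − 2H̃ − 4ẼF̃˜`, BILINEAR FORM**: for every continuous `ℝ`-bilinear `B` and linear `ℓ` on `M₂(ℂ)` with `B(YE, YF̃) = B(YF̃, YE)` and every `Y`,
`−(B(YY₁,YY₁) + ℓ(YY₁²)) + (B(YH,YH) + ℓ(YH²)) + (B(YY₃,YY₃) + ℓ(YY₃²)) = (B(YH,YH) + ℓ(YH²)) − 2•ℓ(YH) − 4•(B(YE,YF̃) + ℓ(Y·EF̃))` — `Y₁ = E + F̃`, `Y₃ = E − F̃` kill the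
squares of `E`, `F̃` and leave `−4 B(YE,YF̃)`; the first-order terms are `3ℓ(Y)` on both sides (`Y₁² = −1`, `H² = Y₃² = 1`, `1 + H + 2EF̃ = 0`).  With `B = D²g(Y)`, `ℓ = Dg(Y)`
the left side is the left-invariant `½tr`-Casimir `(Ω_J g)(Y)` and the right side is `(H̃²g − 2H̃g − 4Ẽ(F̃˜g))(Y)` (`(X̃g)(Y) = d∕ds g(Y e^{sX})`, `[E,F̃] = −H`).
[cite: Varadarajan1989, §6.3] [cite: Knapp1986, Ch. VIII §5] -/
theorem casimirJ_bilinear_eq_flows (B : Matrix (Fin 2) (Fin 2) ℂ →L[ℝ] Matrix (Fin 2) (Fin 2) ℂ →L[ℝ] E) (ℓ : Matrix (Fin 2) (Fin 2) ℂ →L[ℝ] E)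
    (Y : Matrix (Fin 2) (Fin 2) ℂ) (hB : B (Y * !![0, I; 0, 0]) (Y * !![0, 0; I, 0]) = B (Y * !![0, 0; I, 0]) (Y * !![0, I; 0, 0])) :
    -(B (Y * !![0, I; I, 0]) (Y * !![0, I; I, 0]) + ℓ (Y * !![0, I; I, 0] * !![0, I; I, 0])) +
        (B (Y * !![1, 0; 0, -1]) (Y * !![1, 0; 0, -1]) + ℓ (Y * !![1, 0; 0, -1] * !![1, 0; 0, -1])) +
        (B (Y * !![0, I; -I, 0]) (Y * !![0, I; -I, 0]) + ℓ (Y * !![0, I; -I, 0] * !![0, I; -I, 0])) =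
      (B (Y * !![1, 0; 0, -1]) (Y * !![1, 0; 0, -1]) + ℓ (Y * !![1, 0; 0, -1] * !![1, 0; 0, -1])) -
        (2 : ℝ) • ℓ (Y * !![1, 0; 0, -1]) -
        (4 : ℝ) • (B (Y * !![0, I; 0, 0]) (Y * !![0, 0; I, 0]) + ℓ (Y * (!![0, I; 0, 0] * !![0, 0; I, 0]))) := by
  rw [mul_splitFrame_Y₁_mul_Y₁, mul_splitFrame_H_mul_H, mul_splitFrame_Y₃_mul_Y₃, mul_splitFrame_H_eq Y]
  have h1 : Y * !![0, I; I, 0] = Y * !![0, I; 0, 0] + Y * !![0, 0; I, 0] := by rw [← Matrix.mul_add, ← splitFrame_Y₁_eq_add]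
  have h3 : Y * !![0, I; -I, 0] = Y * !![0, I; 0, 0] - Y * !![0, 0; I, 0] := by rw [← Matrix.mul_sub, ← splitFrame_Y₃_eq_sub]
  -- the `H`-slot of `B` stays atomic: rewrite it back before expanding
  have hH : B (-Y - (2 : ℝ) • (Y * (!![0, I; 0, 0] * !![0, 0; I, 0]))) (-Y - (2 : ℝ) • (Y * (!![0, I; 0, 0] * !![0, 0; I, 0]))) =
      B (Y * !![1, 0; 0, -1]) (Y * !![1, 0; 0, -1]) := by rw [← mul_splitFrame_H_eq Y]
  rw [hH, h1, h3]
  simp only [map_add, map_sub, map_neg, map_smul, _root_.add_apply, _root_.sub_apply]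
  rw [← hB]
  module

/-- **`(Ω_J g)(Y) = (H̃²g)(Y) − 2(H̃g)(Y) − 4(Ẽ(F̃˜g))(Y)`** for `g ∈ C²` (`2 ≤ n`): `casimirJ_bilinear_eq_flows` at `B = D²g(Y)` (symmetric: Mathlib `ContDiffAt.isSymmSndFDerivAt`) and `ℓ = Dg(Y)`;
`Ω` is a BOUND operator with its defining hypothesis `hΩ` (Z4's `hΩ` text in the transported basis `(Y₁, H, Y₃)`). [cite: Varadarajan1989, §6.3] [cite: Knapp1986, Ch. VIII §5] -/
theorem casimirJ_apply_eq_flows {n : WithTop ℕ∞} {g : Matrix (Fin 2) (Fin 2) ℂ → E} (hg : ContDiff ℝ n g) (hn : 2 ≤ n)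
    {Ω : (Matrix (Fin 2) (Fin 2) ℂ → E) → Matrix (Fin 2) (Fin 2) ℂ → E}
    (hΩ : ∀ (g : Matrix (Fin 2) (Fin 2) ℂ → E) (Y : Matrix (Fin 2) (Fin 2) ℂ), Ω g Y =
      -(fderiv ℝ (fderiv ℝ g) Y (Y * !![0, I; I, 0]) (Y * !![0, I; I, 0]) + fderiv ℝ g Y (Y * !![0, I; I, 0] * !![0, I; I, 0])) +
        (fderiv ℝ (fderiv ℝ g) Y (Y * !![1, 0; 0, -1]) (Y * !![1, 0; 0, -1]) + fderiv ℝ g Y (Y * !![1, 0; 0, -1] * !![1, 0; 0, -1])) +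
        (fderiv ℝ (fderiv ℝ g) Y (Y * !![0, I; -I, 0]) (Y * !![0, I; -I, 0]) + fderiv ℝ g Y (Y * !![0, I; -I, 0] * !![0, I; -I, 0])))
    (Y : Matrix (Fin 2) (Fin 2) ℂ) :
    Ω g Y = (fderiv ℝ (fderiv ℝ g) Y (Y * !![1, 0; 0, -1]) (Y * !![1, 0; 0, -1]) + fderiv ℝ g Y (Y * !![1, 0; 0, -1] * !![1, 0; 0, -1])) -
        (2 : ℝ) • fderiv ℝ g Y (Y * !![1, 0; 0, -1]) -
        (4 : ℝ) • (fderiv ℝ (fderiv ℝ g) Y (Y * !![0, I; 0, 0]) (Y * !![0, 0; I, 0]) + fderiv ℝ g Y (Y * (!![0, I; 0, 0] * !![0, 0; I, 0]))) := by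
  rw [hΩ]
  have hs : IsSymmSndFDerivAt ℝ g Y := hg.contDiffAt.isSymmSndFDerivAt (by simpa using hn)
  exact casimirJ_bilinear_eq_flows (fderiv ℝ (fderiv ℝ g) Y) (fderiv ℝ g Y) Y (hs.eq _ _)

end Flows

/-! ## §3 `Ad(U(J))`-invariance of `Ω_J` seen by a real bilinear map (transport of ★ `RankOneCasimir.casimir_conj_eq` through the Cayley frame) -/

section Invariance

variable {J : Matrix (Fin 2) (Fin 2) ℂ} (hJ : J = (StdForm.antidiagonal 2).over ℂ)

include hJ in
/-- `P⁻¹ k P ∈ U(diag(2,−2))` for `k ∈ U(J)` (★ `conj_mem_unitaryGroupOfForm_iff` with ★ `formCongr_cayleyTwo_of_eq_over`). [cite: Rogawski1990, §8.2 p. 122] -/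
theorem cayleyTwo_inv_mul_mul_mem_of_mem {k : GL (Fin 2) ℂ} (hk : k ∈ unitaryGroupOfForm (starRingEnd ℂ) J) :
    (Matrix.GeneralLinearGroup.mkOfDetNeZero !![(1 : ℂ), 1; 1, -1] det_cayleyTwo_ne_zero)⁻¹ * k *
        Matrix.GeneralLinearGroup.mkOfDetNeZero !![(1 : ℂ), 1; 1, -1] det_cayleyTwo_ne_zero ∈
      unitaryGroupOfForm (starRingEnd ℂ) (Matrix.diagonal ![(2 : ℂ), -2]) := by
  rw [← formCongr_cayleyTwo_of_eq_over hJ, ← conj_mem_unitaryGroupOfForm_iff]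
  simpa [mul_assoc] using hk

include hJ in
/-- **`Ad(U(J))`-INVARIANCE OF THE CASIMIR SEEN BY A REAL BILINEAR MAP** (split frame): for `k ∈ U(J)` (`J = Φ₂`) and every `ℝ`-bilinear `B` on `M₂(ℂ)`,
**`−B(kY₁k⁻¹, kY₁k⁻¹) + B(kHk⁻¹, kHk⁻¹) + B(kY₃k⁻¹, kY₃k⁻¹) = −B(Y₁,Y₁) + B(H,H) + B(Y₃,Y₃)`** — ★ `RankOneCasimir.casimir_conj_eq` (A-p18, `U(diag e)`, `e = (2,−2)`, `p = q = 1`) at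
`P⁻¹kP ∈ U(diag(2,−2))`, read through `B ∘ (Ad_P × Ad_P)` and the transport `P(X₁,X̂₂,X̂₃)P⁻¹ = (Y₁,H,Y₃)`.  FILE 2 uses it with `B(U,V) = D²g(Y)[YU, YV]` to move the chart
variable `k ∈ K ≤ U(J)` through `Ω_J`. [cite: Hall2015, §3.6, Prop. 3.24] [cite: Varadarajan1989, §6.3] -/
theorem casimirJ_conj_eq_of_mem {E : Type*} [AddCommGroup E] [Module ℝ E] (B : Matrix (Fin 2) (Fin 2) ℂ →ₗ[ℝ] Matrix (Fin 2) (Fin 2) ℂ →ₗ[ℝ] E)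
    {k : GL (Fin 2) ℂ} (hk : k ∈ unitaryGroupOfForm (starRingEnd ℂ) J) :
    -(B ((k : Matrix (Fin 2) (Fin 2) ℂ) * !![0, I; I, 0] * ((k⁻¹ : GL (Fin 2) ℂ) : Matrix (Fin 2) (Fin 2) ℂ))
          ((k : Matrix (Fin 2) (Fin 2) ℂ) * !![0, I; I, 0] * ((k⁻¹ : GL (Fin 2) ℂ) : Matrix (Fin 2) (Fin 2) ℂ))) +
        B ((k : Matrix (Fin 2) (Fin 2) ℂ) * !![1, 0; 0, -1] * ((k⁻¹ : GL (Fin 2) ℂ) : Matrix (Fin 2) (Fin 2) ℂ))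
          ((k : Matrix (Fin 2) (Fin 2) ℂ) * !![1, 0; 0, -1] * ((k⁻¹ : GL (Fin 2) ℂ) : Matrix (Fin 2) (Fin 2) ℂ)) +
        B ((k : Matrix (Fin 2) (Fin 2) ℂ) * !![0, I; -I, 0] * ((k⁻¹ : GL (Fin 2) ℂ) : Matrix (Fin 2) (Fin 2) ℂ))
          ((k : Matrix (Fin 2) (Fin 2) ℂ) * !![0, I; -I, 0] * ((k⁻¹ : GL (Fin 2) ℂ) : Matrix (Fin 2) (Fin 2) ℂ)) =
      -(B !![0, I; I, 0] !![0, I; I, 0]) + B !![1, 0; 0, -1] !![1, 0; 0, -1] + B !![0, I; -I, 0] !![0, I; -I, 0] := by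
  -- the Cayley matrix and the transported element `g = P⁻¹ k P ∈ U(diag(2,−2))`
  set P : GL (Fin 2) ℂ := Matrix.GeneralLinearGroup.mkOfDetNeZero !![(1 : ℂ), 1; 1, -1] det_cayleyTwo_ne_zero with hPdef
  have hg := cayleyTwo_inv_mul_mul_mem_of_mem hJ hk
  rw [← hPdef] at hg
  have hTH := (mem_unitaryGroupOfForm_star_iff_conjTranspose _ _).1 hg
  have hTT' : ((P⁻¹ * k * P : GL (Fin 2) ℂ) : Matrix (Fin 2) (Fin 2) ℂ) * (((P⁻¹ * k * P)⁻¹ : GL (Fin 2) ℂ) : Matrix (Fin 2) (Fin 2) ℂ) = 1 := by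
    rw [← Units.val_mul, mul_inv_cancel, Units.val_one]
  -- `B′ = B ∘ (Ad_P × Ad_P)`
  set Ad : Matrix (Fin 2) (Fin 2) ℂ →ₗ[ℝ] Matrix (Fin 2) (Fin 2) ℂ :=
    (LinearMap.mulLeft ℝ (P : Matrix (Fin 2) (Fin 2) ℂ)).comp (LinearMap.mulRight ℝ ((P⁻¹ : GL (Fin 2) ℂ) : Matrix (Fin 2) (Fin 2) ℂ)) with hAd_def
  have hAd : ∀ X, Ad X = (P : Matrix (Fin 2) (Fin 2) ℂ) * X * ((P⁻¹ : GL (Fin 2) ℂ) : Matrix (Fin 2) (Fin 2) ℂ) := fun X => by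
    simp only [hAd_def, LinearMap.comp_apply, LinearMap.mulLeft_apply, LinearMap.mulRight_apply, Matrix.mul_assoc]
  set B' : Matrix (Fin 2) (Fin 2) ℂ →ₗ[ℝ] Matrix (Fin 2) (Fin 2) ℂ →ₗ[ℝ] E := B.compl₁₂ Ad Ad with hB'_def
  have hB' : ∀ X Y, B' X Y = B ((P : Matrix (Fin 2) (Fin 2) ℂ) * X * ((P⁻¹ : GL (Fin 2) ℂ) : Matrix (Fin 2) (Fin 2) ℂ))
      ((P : Matrix (Fin 2) (Fin 2) ℂ) * Y * ((P⁻¹ : GL (Fin 2) ℂ) : Matrix (Fin 2) (Fin 2) ℂ)) := fun X Y => by rw [hB'_def, LinearMap.compl₁₂_apply, hAd, hAd]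
  -- ★ Z1 at `e = (2,−2)`, `p = q = 1`
  have he : ∀ i, (![(2 : ℂ), -2] i) ≠ 0 := fun i => by fin_cases i <;> simp
  have hereal : ∀ i, conj (![(2 : ℂ), -2] i) = ![(2 : ℂ), -2] i := fun i => by
    fin_cases i <;> simp [Complex.ext_iff]
  have hqe : (((1 : ℝ) : ℂ)) ^ 2 * ![(2 : ℂ), -2] 1 = -(![(2 : ℂ), -2] 0) := by simp
  have h := RankOneCasimir.casimir_conj_eq B' (p := 1) (q := 1) (by norm_num) ![(2 : ℂ), -2] he hereal hqe hTH hTT'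
  -- read both sides through `Ad_P`
  have hconj : ∀ X : Matrix (Fin 2) (Fin 2) ℂ,
      (P : Matrix (Fin 2) (Fin 2) ℂ) * (((P⁻¹ * k * P : GL (Fin 2) ℂ) : Matrix (Fin 2) (Fin 2) ℂ) * X * (((P⁻¹ * k * P)⁻¹ : GL (Fin 2) ℂ) : Matrix (Fin 2) (Fin 2) ℂ)) *
          ((P⁻¹ : GL (Fin 2) ℂ) : Matrix (Fin 2) (Fin 2) ℂ) =
        (k : Matrix (Fin 2) (Fin 2) ℂ) * ((P : Matrix (Fin 2) (Fin 2) ℂ) * X * ((P⁻¹ : GL (Fin 2) ℂ) : Matrix (Fin 2) (Fin 2) ℂ)) *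
          ((k⁻¹ : GL (Fin 2) ℂ) : Matrix (Fin 2) (Fin 2) ℂ) := fun X => by
    simp only [_root_.mul_inv_rev, inv_inv, Units.val_mul, Matrix.mul_assoc, Units.mul_inv_cancel_left, Units.mul_inv, Matrix.mul_one]
  simp only [hB', hconj] at h
  rw [show (!![(0 : ℂ), ((1 : ℝ) : ℂ); ((1 : ℝ) : ℂ), 0] : Matrix (Fin 2) (Fin 2) ℂ) = !![(0 : ℂ), ((1 : ℝ) : ℂ); ((1 : ℝ) : ℂ), 0] from rfl] at h
  rw [cayleyTwo_conj_X₁, cayleyTwo_conj_X₂, cayleyTwo_conj_X₃] at h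
  exact h

/-- **First-order companion**: `k (−Y₁² + H² + Y₃²) k⁻¹ = 3 = −Y₁² + H² + Y₃²`, in the form FILE 2 uses: for every `ℝ`-linear `ℓ` and `k ∈ GL₂(ℂ)`,
`−ℓ(W·(kY₁k⁻¹)²) + ℓ(W·(kHk⁻¹)²) + ℓ(W·(kY₃k⁻¹)²) = −ℓ(W Y₁²) + ℓ(W H²) + ℓ(W Y₃²)` (both are `3 ℓ(W)`). [cite: Hall2015, §3.6] -/
theorem casimirJ_firstOrder_conj_eq {E : Type*} [AddCommGroup E] [Module ℝ E] (ℓ : Matrix (Fin 2) (Fin 2) ℂ →ₗ[ℝ] E) (k : GL (Fin 2) ℂ)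
    (W : Matrix (Fin 2) (Fin 2) ℂ) :
    -(ℓ (W * ((k : Matrix (Fin 2) (Fin 2) ℂ) * !![0, I; I, 0] * ((k⁻¹ : GL (Fin 2) ℂ) : Matrix (Fin 2) (Fin 2) ℂ)) *
          ((k : Matrix (Fin 2) (Fin 2) ℂ) * !![0, I; I, 0] * ((k⁻¹ : GL (Fin 2) ℂ) : Matrix (Fin 2) (Fin 2) ℂ)))) +
        ℓ (W * ((k : Matrix (Fin 2) (Fin 2) ℂ) * !![1, 0; 0, -1] * ((k⁻¹ : GL (Fin 2) ℂ) : Matrix (Fin 2) (Fin 2) ℂ)) *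
          ((k : Matrix (Fin 2) (Fin 2) ℂ) * !![1, 0; 0, -1] * ((k⁻¹ : GL (Fin 2) ℂ) : Matrix (Fin 2) (Fin 2) ℂ))) +
        ℓ (W * ((k : Matrix (Fin 2) (Fin 2) ℂ) * !![0, I; -I, 0] * ((k⁻¹ : GL (Fin 2) ℂ) : Matrix (Fin 2) (Fin 2) ℂ)) *
          ((k : Matrix (Fin 2) (Fin 2) ℂ) * !![0, I; -I, 0] * ((k⁻¹ : GL (Fin 2) ℂ) : Matrix (Fin 2) (Fin 2) ℂ))) =
      -(ℓ (W * !![0, I; I, 0] * !![0, I; I, 0])) + ℓ (W * !![1, 0; 0, -1] * !![1, 0; 0, -1]) + ℓ (W * !![0, I; -I, 0] * !![0, I; -I, 0]) := by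
  have hkk : ((k⁻¹ : GL (Fin 2) ℂ) : Matrix (Fin 2) (Fin 2) ℂ) * (k : Matrix (Fin 2) (Fin 2) ℂ) = 1 := by
    rw [← Units.val_mul, inv_mul_cancel, Units.val_one]
  have hsq : ∀ X : Matrix (Fin 2) (Fin 2) ℂ,
      W * ((k : Matrix (Fin 2) (Fin 2) ℂ) * X * ((k⁻¹ : GL (Fin 2) ℂ) : Matrix (Fin 2) (Fin 2) ℂ)) * ((k : Matrix (Fin 2) (Fin 2) ℂ) * X * ((k⁻¹ : GL (Fin 2) ℂ) : Matrix (Fin 2) (Fin 2) ℂ)) =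
        W * (k : Matrix (Fin 2) (Fin 2) ℂ) * (X * X) * ((k⁻¹ : GL (Fin 2) ℂ) : Matrix (Fin 2) (Fin 2) ℂ) := fun X => by
    calc W * ((k : Matrix (Fin 2) (Fin 2) ℂ) * X * ((k⁻¹ : GL (Fin 2) ℂ) : Matrix (Fin 2) (Fin 2) ℂ)) * ((k : Matrix (Fin 2) (Fin 2) ℂ) * X * ((k⁻¹ : GL (Fin 2) ℂ) : Matrix (Fin 2) (Fin 2) ℂ))
        = W * (k : Matrix (Fin 2) (Fin 2) ℂ) * X * (((k⁻¹ : GL (Fin 2) ℂ) : Matrix (Fin 2) (Fin 2) ℂ) * (k : Matrix (Fin 2) (Fin 2) ℂ)) * X *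
            ((k⁻¹ : GL (Fin 2) ℂ) : Matrix (Fin 2) (Fin 2) ℂ) := by simp only [Matrix.mul_assoc]
      _ = W * (k : Matrix (Fin 2) (Fin 2) ℂ) * (X * X) * ((k⁻¹ : GL (Fin 2) ℂ) : Matrix (Fin 2) (Fin 2) ℂ) := by rw [hkk, Matrix.mul_one]; simp only [Matrix.mul_assoc]
  rw [hsq, hsq, hsq, splitFrame_Y₁_mul_Y₁, splitFrame_H_mul_H, splitFrame_Y₃_mul_Y₃, mul_splitFrame_Y₁_mul_Y₁, mul_splitFrame_H_mul_H, mul_splitFrame_Y₃_mul_Y₃]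
  have h1 : W * (k : Matrix (Fin 2) (Fin 2) ℂ) * (1 : Matrix (Fin 2) (Fin 2) ℂ) * ((k⁻¹ : GL (Fin 2) ℂ) : Matrix (Fin 2) (Fin 2) ℂ) = W := by
    rw [Matrix.mul_one, Matrix.mul_assoc, ← Units.val_mul, mul_inv_cancel, Units.val_one, Matrix.mul_one]
  have hn1 : W * (k : Matrix (Fin 2) (Fin 2) ℂ) * (-1 : Matrix (Fin 2) (Fin 2) ℂ) * ((k⁻¹ : GL (Fin 2) ℂ) : Matrix (Fin 2) (Fin 2) ℂ) = -W := by
    rw [Matrix.mul_neg, Matrix.neg_mul, h1]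
  rw [h1, hn1]

end Invariance

end UnitaryGroup

end Literature.NumberTheory.Automorphic

end
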